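import Mathlib.Analysis.Fourier.FourierTransformDeriv
import Mathlib.Analysis.PSeries
import Mathlib.Analysis.SpecialFunctions.ImproperIntegrals
import Mathlib.Analysis.SpecialFunctions.SmoothTransition
import Mathlib.Analysis.Calculus.BumpFunction.InnerProduct
import Mathlib.Analysis.Calculus.MeanValue
import Mathlib.Analysis.Complex.RealDeriv
import Mathlib.MeasureTheory.Integral.DominatedConvergence
import HarnessLib

/-!
# The 1-D spectral lemma of line `signed-root-silent-field` — part A: analytic toolbox

The registered stub `stub_rodLemma` (skeleton `Cruxes/SlackRigidity/Lines/signed-root-silent-field.lean`,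
lead c2; crux `SlackRigidity`, stmt-AtomisticToContinuum-11960): a bounded sequence `u : ℤ → ℂ` with
`Σ_k u_k c(t − kh) = 0` for all real `t`, where `c` is continuous, `O((1+|t|)⁻²)`, and `𝓕c` is `C²`
and zero-free on `(1/(2h), 1/h) ∪ (−1/h, −1/(2h))`, is `2`-periodic.  Proof WITHOUT Wiener division
or distributions: test the identity against `𝓕(φ/𝓕c)` (multiplication formula) to annihilate every
`C_c²` test function supported in a good interval; integer translates of the two good intervals cover
`ℝ ∖ ½ℤ`; shrinking bumps extend the annihilation to test functions with vanishing `2`-jets on `½ℤ`;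
pairing with `𝐞(k₀·)(𝐞(2·) − 1)³ Q₀` (`𝓕Q₀|_ℤ = q δ₀`) gives a vanishing third difference of
`n ↦ u(k₀ + 2n)`, and a bounded sequence with vanishing third difference is constant.
All `[folklore]` (Rudin, *Functional Analysis* Thm 9.3; Katznelson, *Harmonic Analysis* Ch. VI).

This part: the uniform shift bound `Σ_k (1+|t−k|)⁻² ≤ S₀`, the dominated interchange
`Σ_k u_k ∫ ψ(t) c(t−k) dt = 0` for integrable `ψ`, decay `‖𝓕g(ξ)‖ ≤ (∫‖g‖+∫‖g''‖)(1+ξ²)⁻¹` for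
`g ∈ C_c²`, and the `ℓ¹` bound `Σ_k ‖𝓕g(k)‖ ≤ 2S₀(∫‖g‖ + ∫‖g''‖)`.
-/

noncomputable section

open scoped BigOperators Topology FourierTransform Real
open MeasureTheory Filter Set Complex

namespace Summit.AtomisticToContinuum.Crystallization.Theorems.SignedRootRodLemma

/-! ## Uniform summability of the shifted inverse squares -/

/-- `Σ_{n ≥ 0} (n+1)⁻²`-type summability over `ℤ`: `k ↦ (1 + |k|)⁻²` is summable. [folklore] -/
theorem summable_one_div_one_add_abs_sq : Summable fun k : ℤ => 1 / (1 + |(k : ℝ)|) ^ 2 := by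
  have hnat : Summable fun n : ℕ => 1 / (1 + (n : ℝ)) ^ 2 := by
    have h := (summable_nat_add_iff 1).2 (Real.summable_one_div_nat_pow.2 one_lt_two)
    refine h.congr fun n => ?_
    simp only [Nat.cast_add, Nat.cast_one]
    ring
  refine Summable.of_nat_of_neg ?_ ?_
  · refine hnat.congr fun n => ?_
    simp only [Int.cast_natCast, Nat.abs_cast]
  · refine hnat.congr fun n => ?_
    simp only [Int.cast_neg, Int.cast_natCast, abs_neg, Nat.abs_cast]

/-- The constant `S₀ = Σ_k 4 (1 + |k|)⁻²`. [folklore] -/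
def S₀ : ℝ := ∑' k : ℤ, 4 / (1 + |(k : ℝ)|) ^ 2

/-- `S₀` is nonnegative. [folklore] -/
theorem S₀_nonneg : 0 ≤ S₀ := tsum_nonneg fun k => by positivity

/-- **Uniform bound for the shifted inverse squares**: for every real `t`, `k ↦ (1 + |t − k|)⁻²` is
summable and its sum is at most `S₀` (round `t` to the nearest integer). [folklore] -/
theorem summable_shift_sq_and_tsum_le (t : ℝ) :
    Summable (fun k : ℤ => 1 / (1 + |t - k|) ^ 2) ∧ ∑' k : ℤ, 1 / (1 + |t - k|) ^ 2 ≤ S₀ := by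
  set n₀ : ℤ := round t with hn₀
  -- termwise comparison with the recentred sequence
  have hle : ∀ k : ℤ, 1 / (1 + |t - k|) ^ 2 ≤ 4 / (1 + |((k - n₀ : ℤ) : ℝ)|) ^ 2 := by
    intro k
    have h1 : |((k - n₀ : ℤ) : ℝ)| ≤ |t - k| + 1 / 2 := by
      have hr : |t - n₀| ≤ 1 / 2 := abs_sub_round t
      calc |((k - n₀ : ℤ) : ℝ)| = |(t - n₀) - (t - k)| := by push_cast; ring_nf
        _ ≤ |t - n₀| + |t - k| := abs_sub _ _
        _ ≤ |t - k| + 1 / 2 := by linarith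
    have h2 : (1 + |((k - n₀ : ℤ) : ℝ)|) ≤ 2 * (1 + |t - k|) := by linarith [abs_nonneg (t - k)]
    have h4 : 0 < 1 + |((k - n₀ : ℤ) : ℝ)| := by positivity
    have hsq : (1 + |((k - n₀ : ℤ) : ℝ)|) ^ 2 ≤ 4 * (1 + |t - k|) ^ 2 := by
      have := pow_le_pow_left₀ h4.le h2 2
      rwa [mul_pow, show (2 : ℝ) ^ 2 = 4 by norm_num] at this
    calc 1 / (1 + |t - k|) ^ 2 = 4 / (4 * (1 + |t - k|) ^ 2) := by
          field_simp
      _ ≤ 4 / (1 + |((k - n₀ : ℤ) : ℝ)|) ^ 2 :=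
          div_le_div_of_nonneg_left (by norm_num) (by positivity) hsq
  have h4 : Summable fun k : ℤ => 4 / (1 + |(k : ℝ)|) ^ 2 := by
    refine (summable_one_div_one_add_abs_sq.mul_left 4).congr fun k => ?_
    ring
  have hshift : Summable ((fun k : ℤ => 4 / (1 + |(k : ℝ)|) ^ 2) ∘ (Equiv.subRight n₀)) :=
    (Equiv.summable_iff _).2 h4
  have hle' : ∀ k : ℤ, 1 / (1 + |t - k|) ^ 2 ≤
      ((fun k : ℤ => 4 / (1 + |(k : ℝ)|) ^ 2) ∘ (Equiv.subRight n₀)) k := by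
    intro k
    simp only [Function.comp_apply, Equiv.subRight_apply, Int.cast_sub]
    have := hle k
    push_cast at this
    exact this
  have hsum : Summable fun k : ℤ => 1 / (1 + |t - k|) ^ 2 :=
    hshift.of_nonneg_of_le (fun k => by positivity) hle'
  refine ⟨hsum, ?_⟩
  have heq : ∑' k : ℤ, ((fun k : ℤ => 4 / (1 + |(k : ℝ)|) ^ 2) ∘ (Equiv.subRight n₀)) k =
      ∑' k : ℤ, 4 / (1 + |(k : ℝ)|) ^ 2 :=
    (Equiv.subRight n₀).tsum_eq (fun k : ℤ => 4 / (1 + |(k : ℝ)|) ^ 2)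
  calc ∑' k : ℤ, 1 / (1 + |t - k|) ^ 2
      ≤ ∑' k : ℤ, ((fun k : ℤ => 4 / (1 + |(k : ℝ)|) ^ 2) ∘ (Equiv.subRight n₀)) k :=
        hsum.tsum_le_tsum hle' hshift
    _ = ∑' k : ℤ, 4 / (1 + |(k : ℝ)|) ^ 2 := heq
    _ = S₀ := rfl

/-! ## Testing the annihilation identity against an integrable function -/

/-- **Mollification of the annihilation identity.**  If `u` is bounded, `c` is continuous with
`‖c(t)‖ ≤ C (1+|t|)⁻²`, and `Σ_k u_k c(t − k) = 0` for every real `t`, then for every integrable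
`ψ`, `Σ_k u_k ∫ ψ(t) c(t − k) dt = 0` (dominated interchange of sum and integral). [folklore] -/
theorem hasSum_mul_integral_shift {u : ℤ → ℂ} {c ψ : ℝ → ℂ} {M C : ℝ}
    (hu : ∀ k, ‖u k‖ ≤ M) (hc : Continuous c) (hcd : ∀ t : ℝ, ‖c t‖ ≤ C / (1 + |t|) ^ 2)
    (hψ : Integrable ψ) (hsum : ∀ t : ℝ, HasSum (fun k : ℤ => u k * c (t - k)) 0) :
    HasSum (fun k : ℤ => u k * ∫ t : ℝ, ψ t * c (t - k)) 0 := by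
  have hM : 0 ≤ M := (norm_nonneg _).trans (hu 0)
  have hC : 0 ≤ C := by
    have h := hcd 0
    simp only [abs_zero, add_zero, one_pow, div_one] at h
    exact (norm_nonneg _).trans h
  -- the summands as functions of `t`
  set F : ℤ → ℝ → ℂ := fun k t => ψ t * (u k * c (t - k)) with hF
  have hFmeas : ∀ k, AEStronglyMeasurable (F k) volume := fun k =>
    hψ.aestronglyMeasurable.mul
      ((hc.comp (continuous_id.sub continuous_const)).aestronglyMeasurable.const_mul (u k))
  have hFbound : ∀ k t, ‖F k t‖ ≤ ‖ψ t‖ * (M * C) * (1 / (1 + |t - k|) ^ 2) := by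
    intro k t
    rw [hF]
    simp only [norm_mul]
    have h1 := hu k
    have h2 := hcd (t - k)
    have h3 : 0 ≤ 1 / (1 + |t - (k : ℝ)|) ^ 2 := by positivity
    calc ‖ψ t‖ * (‖u k‖ * ‖c (t - k)‖) ≤ ‖ψ t‖ * (M * (C / (1 + |t - k|) ^ 2)) := by
          gcongr
      _ = ‖ψ t‖ * (M * C) * (1 / (1 + |t - k|) ^ 2) := by ring
  have hFint : ∀ k, Integrable (F k) := by
    intro k
    refine Integrable.mono' ((hψ.norm.mul_const (M * C)).mul_const (1 / (1 + |(0 : ℝ)|) ^ 2))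
      (hFmeas k) (Eventually.of_forall fun t => (hFbound k t).trans ?_)
    have : 1 / (1 + |t - (k : ℝ)|) ^ 2 ≤ 1 / (1 + |(0 : ℝ)|) ^ 2 := by
      rw [abs_zero, add_zero, one_pow, div_one]
      rw [div_le_one (by positivity)]
      nlinarith [abs_nonneg (t - (k : ℝ))]
    exact mul_le_mul_of_nonneg_left this (by positivity)
  -- summability of the integrated norms, by the uniform shift bound
  have hnorm_sum : Summable fun k : ℤ => ∫ t, ‖F k t‖ := by
    refine summable_of_sum_le (c := (∫ t, ‖ψ t‖) * (M * C) * S₀)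
      (fun k => integral_nonneg fun t => norm_nonneg _) fun s => ?_
    have hint : ∀ k ∈ s, Integrable (fun t => ‖F k t‖) := fun k _ => (hFint k).norm
    rw [← integral_finsetSum s hint]
    have hle : ∀ t, ∑ k ∈ s, ‖F k t‖ ≤ ‖ψ t‖ * (M * C) * S₀ := by
      intro t
      obtain ⟨hs1, hs2⟩ := summable_shift_sq_and_tsum_le t
      calc ∑ k ∈ s, ‖F k t‖ ≤ ∑ k ∈ s, ‖ψ t‖ * (M * C) * (1 / (1 + |t - k|) ^ 2) :=
            Finset.sum_le_sum fun k _ => hFbound k t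
        _ = ‖ψ t‖ * (M * C) * ∑ k ∈ s, 1 / (1 + |t - k|) ^ 2 := by rw [Finset.mul_sum]
        _ ≤ ‖ψ t‖ * (M * C) * S₀ := by
            refine mul_le_mul_of_nonneg_left ?_ (by positivity)
            exact (hs1.sum_le_tsum s fun k _ => by positivity).trans hs2
    calc ∫ t, ∑ k ∈ s, ‖F k t‖ ≤ ∫ t, ‖ψ t‖ * (M * C) * S₀ := by
          refine integral_mono (integrable_finsetSum s hint) ?_ hle
          exact (hψ.norm.mul_const _).mul_const _
      _ = (∫ t, ‖ψ t‖) * (M * C) * S₀ := by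
          rw [integral_mul_const, integral_mul_const]
  -- interchange
  have hmain := hasSum_integral_of_summable_integral_norm hFint hnorm_sum
  have hzero : (∫ t, ∑' k, F k t) = 0 := by
    have : (fun t => ∑' k, F k t) = fun _ => 0 := by
      funext t
      rw [hF]
      simp only
      rw [tsum_mul_left, (hsum t).tsum_eq, mul_zero]
    rw [this, integral_zero]
  rw [hzero] at hmain
  have hfun : (fun k => ∫ a, F k a) = fun k => u k * ∫ t : ℝ, ψ t * c (t - k) := by
    funext k
    rw [hF]
    simp only
    rw [← integral_const_mul]
    congr 1
    funext t
    ring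
  rw [hfun] at hmain
  exact hmain

/-! ## Fourier transforms of `C²` functions with compact support -/

/-- A continuous compactly supported function `ℝ → ℂ` is integrable. [folklore] -/
theorem integrable_of_hasCompactSupport {g : ℝ → ℂ} (hg : Continuous g) (hgs : HasCompactSupport g) :
    Integrable g :=
  hg.integrable_of_hasCompactSupport hgs

/-- **Decay of the Fourier transform of a `C_c²` function**: `‖𝓕 g ξ‖ ≤ A/(1+ξ²)` with
`A = ∫‖g‖ + ∫‖g''‖` (two integrations by parts, `Real.fourier_deriv`). [folklore] -/
theorem norm_fourier_le_of_contDiff_two {g : ℝ → ℂ} (hg : ContDiff ℝ 2 g)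
    (hgs : HasCompactSupport g) (ξ : ℝ) :
    ‖𝓕 g ξ‖ ≤ ((∫ t, ‖g t‖) + ∫ t, ‖deriv (deriv g) t‖) / (1 + ξ ^ 2) := by
  -- regularity bookkeeping
  have hg1 : Differentiable ℝ g := hg.differentiable (by norm_num)
  have hdg : ContDiff ℝ 1 (deriv g) := hg.deriv'
  have hdg1 : Differentiable ℝ (deriv g) := hg.differentiable_deriv_two
  have hddg : Continuous (deriv (deriv g)) := hdg.continuous_deriv_one
  have hgs1 : HasCompactSupport (deriv g) := hgs.deriv
  have hgs2 : HasCompactSupport (deriv (deriv g)) := hgs1.deriv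
  have hgi : Integrable g := hg.continuous.integrable_of_hasCompactSupport hgs
  have hdgi : Integrable (deriv g) := hdg.continuous.integrable_of_hasCompactSupport hgs1
  have hddgi : Integrable (deriv (deriv g)) := hddg.integrable_of_hasCompactSupport hgs2
  -- two integrations by parts
  have h1 : 𝓕 (deriv g) = fun x : ℝ => (2 * π * I * x) • 𝓕 g x := Real.fourier_deriv hgi hg1 hdgi
  have h2 : 𝓕 (deriv (deriv g)) = fun x : ℝ => (2 * π * I * x) • 𝓕 (deriv g) x :=
    Real.fourier_deriv hdgi hdg1 hddgi
  have hkey : 𝓕 (deriv (deriv g)) ξ = ((2 * π * I * ξ) * (2 * π * I * ξ)) • 𝓕 g ξ := by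
    rw [h2]
    simp only
    rw [h1]
    simp only [smul_smul]
  -- norm bounds
  have hA : ‖𝓕 g ξ‖ ≤ ∫ t, ‖g t‖ :=
    VectorFourier.norm_fourierIntegral_le_integral_norm _ _ _ _ _
  have hB : (4 * π ^ 2 * ξ ^ 2) * ‖𝓕 g ξ‖ ≤ ∫ t, ‖deriv (deriv g) t‖ := by
    have hn : ‖𝓕 (deriv (deriv g)) ξ‖ ≤ ∫ t, ‖deriv (deriv g) t‖ :=
      VectorFourier.norm_fourierIntegral_le_integral_norm _ _ _ _ _
    rw [hkey, norm_smul] at hn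
    have hc : ‖(2 * (π : ℂ) * I * ξ) * (2 * π * I * ξ)‖ = 4 * π ^ 2 * ξ ^ 2 := by
      rw [show (2 * (π : ℂ) * I * ξ) * (2 * π * I * ξ) = ((-(4 * π ^ 2 * ξ ^ 2) : ℝ) : ℂ) by
        push_cast; ring_nf; rw [Complex.I_sq]; ring]
      rw [Complex.norm_real, Real.norm_eq_abs, abs_neg, abs_of_nonneg (by positivity)]
    rwa [hc] at hn
  -- combine: `(1 + ξ²) ‖𝓕 g ξ‖ ≤ A`, using `4π² ≥ 1`
  have hπ : (1 : ℝ) ≤ 4 * π ^ 2 := by nlinarith [Real.two_le_pi]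
  have hpos : 0 < 1 + ξ ^ 2 := by positivity
  rw [le_div_iff₀ hpos]
  have hnn : 0 ≤ ‖𝓕 g ξ‖ := norm_nonneg _
  have : ξ ^ 2 * ‖𝓕 g ξ‖ ≤ ∫ t, ‖deriv (deriv g) t‖ := by
    have h0 : ξ ^ 2 * ‖𝓕 g ξ‖ ≤ (4 * π ^ 2 * ξ ^ 2) * ‖𝓕 g ξ‖ := by
      have := mul_le_mul_of_nonneg_right hπ (mul_nonneg (sq_nonneg ξ) hnn)
      nlinarith
    exact h0.trans hB
  nlinarith

/-- The Fourier transform of a `C_c²` function is integrable (and continuous). [folklore] -/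
theorem integrable_fourier_of_contDiff_two {g : ℝ → ℂ} (hg : ContDiff ℝ 2 g)
    (hgs : HasCompactSupport g) : Integrable (𝓕 g) ∧ Continuous (𝓕 g) := by
  have hgi : Integrable g := hg.continuous.integrable_of_hasCompactSupport hgs
  have hcont : Continuous (𝓕 g) := by
    rw [show 𝓕 g = VectorFourier.fourierIntegral Real.fourierChar volume (innerₗ ℝ) g from rfl]
    exact VectorFourier.fourierIntegral_continuous Real.continuous_fourierChar
      (by exact continuous_inner) hgi
  refine ⟨?_, hcont⟩
  set A : ℝ := (∫ t, ‖g t‖) + ∫ t, ‖deriv (deriv g) t‖ with hA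
  refine Integrable.mono' (integrable_inv_one_add_sq.const_mul A) hcont.aestronglyMeasurable
    (Eventually.of_forall fun ξ => ?_)
  have := norm_fourier_le_of_contDiff_two hg hgs ξ
  simpa [div_eq_mul_inv] using this

/-- **`ℓ¹` bound for the integer samples of the Fourier transform of a `C_c²` function**:
`Σ_k ‖𝓕 g k‖ ≤ 2 S₀ (∫‖g‖ + ∫‖g''‖)` (and the series converges). [folklore] -/
theorem summable_norm_fourier_int_and_tsum_le {g : ℝ → ℂ} (hg : ContDiff ℝ 2 g)
    (hgs : HasCompactSupport g) :
    Summable (fun k : ℤ => ‖𝓕 g k‖) ∧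
      ∑' k : ℤ, ‖𝓕 g k‖ ≤ 2 * S₀ * ((∫ t, ‖g t‖) + ∫ t, ‖deriv (deriv g) t‖) := by
  set A : ℝ := (∫ t, ‖g t‖) + ∫ t, ‖deriv (deriv g) t‖ with hA
  have hA0 : 0 ≤ A := add_nonneg (integral_nonneg fun _ => norm_nonneg _)
    (integral_nonneg fun _ => norm_nonneg _)
  obtain ⟨hs0, hs0le⟩ := summable_shift_sq_and_tsum_le 0
  -- `(1 + k²)⁻¹ ≤ 2 (1 + |k|)⁻²`
  have hcmp : ∀ k : ℤ, ‖𝓕 g k‖ ≤ (2 * A) * (1 / (1 + |(0 : ℝ) - k|) ^ 2) := by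
    intro k
    have h1 := norm_fourier_le_of_contDiff_two hg hgs k
    have h2 : A / (1 + (k : ℝ) ^ 2) ≤ (2 * A) * (1 / (1 + |(0 : ℝ) - k|) ^ 2) := by
      rw [zero_sub, abs_neg]
      have hk : (1 + |(k : ℝ)|) ^ 2 ≤ 2 * (1 + (k : ℝ) ^ 2) := by
        have : |(k : ℝ)| ^ 2 = (k : ℝ) ^ 2 := sq_abs _
        nlinarith [abs_nonneg (k : ℝ), sq_nonneg (|(k : ℝ)| - 1)]
      rw [div_le_iff₀ (by positivity)]
      calc A = (2 * A) * (1 / (1 + |(k : ℝ)|) ^ 2) * ((1 + |(k : ℝ)|) ^ 2 / 2) := by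
            field_simp
        _ ≤ (2 * A) * (1 / (1 + |(k : ℝ)|) ^ 2) * (1 + (k : ℝ) ^ 2) := by
            refine mul_le_mul_of_nonneg_left (by linarith) (by positivity)
    exact h1.trans h2
  have hsum : Summable (fun k : ℤ => ‖𝓕 g k‖) :=
    (hs0.mul_left (2 * A)).of_nonneg_of_le (fun k => norm_nonneg _) hcmp
  refine ⟨hsum, ?_⟩
  calc ∑' k : ℤ, ‖𝓕 g k‖ ≤ ∑' k : ℤ, (2 * A) * (1 / (1 + |(0 : ℝ) - k|) ^ 2) :=
        hsum.tsum_le_tsum hcmp (hs0.mul_left _)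
    _ = (2 * A) * ∑' k : ℤ, 1 / (1 + |(0 : ℝ) - k|) ^ 2 := tsum_mul_left
    _ ≤ (2 * A) * S₀ := mul_le_mul_of_nonneg_left hs0le (by positivity)
    _ = 2 * S₀ * A := by ring

/-- Anchor of this helper file (registered obligation): the shifted inverse squares are summable. [folklore] -/
theorem rodLemmaA_anchor : ∀ t : ℝ, Summable (fun k : ℤ => 1 / (1 + |t - k|) ^ 2) :=
  fun t => (summable_shift_sq_and_tsum_le t).1

end Summit.AtomisticToContinuum.Crystallization.Theorems.SignedRootRodLemma

end
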